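import Summits.QuantumAdvantage.QuantumAdvantage.Theorems.CharDialMaskDialC
import HarnessLib

/-!
# The mask dial, part D: ★★★ `maskDial_hard` — the FREEZE-ALL-FORMS CEILING dial — and its consistency with the null dial (decomp-qadv lens-6 g18 «NullDial» REV2, tree part 31F)

THE MASK DIAL.  Data: pairwise separated span windows `[S k, S k + ℓ)` in `{0,…,n−1}` and a mask `Z`; the masked blocks `zblk k = [S k, S k+ℓ) ∩ Z`
all have size `m ≢ 0 (mod 3)`.  Hypothesis: every cut's presented coefficient vector mod `p` is ZERO-SUM ON EVERY MASKED BLOCK (arbitrary elsewhere,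
arbitrary tables).  Conclusion: with `M ≥ 2^m (N₁+1)` and `M ≥ 2^m ((L+1)²+1)` masked blocks, a junta-`≤ L` ⊕ linear-form strategy wins the mod-3
walk game on at most `θ·2ⁿ` inputs, `θ < 1` ABSOLUTE (uniform in `ℓ, m, p, Z`).  This is the most general re-set dial: ANY family of pairwise
disjoint common zero-sum sets `Z_1, …, Z_M` of sizes `≢ 0 (mod 3)` whose convex hulls are pairwise disjoint is an instance (`ℓ` = the largest
hull, `Z = ⋃ Z_k`); the null dial (31A/31B) is `Z ⊇ ⋃ spans`, the block dial (30M–30Q) is `ℓ = p`, constant forms.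
Assembly = generic dial assembly `dialZ_of_pieces` (tiling 31D + tail 31E + transport 31D) over the piece engine `maskPiece_hard` (31C).
Supports item stmt-QuantumAdvantage-32604 (`CharDial.WalkHardFJLinOdd`); source: pub annex g18/OrbitDial38.lean REV2 (sha256 7aeccba348e162ea…) §38h, namespace `…Theses.OrbitDial.MaskDial`,
statements and proofs verbatim (Prop-free).
-/

set_option autoImplicit false

namespace Summit.QuantumAdvantage.AdviceFreeQNC0.JLinPeel.MaskDial

open Finset
open Summit.QuantumAdvantage.AdviceFreeQNC0
open Summit.QuantumAdvantage.AdviceFreeQNC0.JLinPeel.BlockDial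
open Literature.Computability.MetaComplexity Literature.Computability.MetaComplexity.Smolensky

section MaskAssembly
open Classical
variable {n M : ℕ} {ℓ m : ℕ} {S : Fin M → ℕ} {Z : Finset (Fin n)}

/-- **the generic mask-dial assembly**: a piece bound `θ ≤ 1` valid through every input with `> T` free masked blocks of a family of
`M ≥ 2^m (T+1)` masked blocks of size `m ≥ 1` gives the global bound `(1+θ)/2` for the property (tiling `sum_card_BsetZ` + tail
`card_few_constZ_le_half` + transport `card_BsetZ_le_gen`). -/
theorem dialZ_of_pieces (h : ((∀ k k', k < k' → S k + ℓ ≤ S k') ∧ (∀ k, S k + ℓ ≤ n))) (hm : ∀ k, (zblk ℓ S Z k).card = m) (hm1 : 1 ≤ m)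
    {θ : ℝ} (hθ1 : θ ≤ 1) {T : ℕ} (hMT : 2 ^ m * (T + 1) ≤ M) (P : (Fin n → Bool) → Prop) [DecidablePred P]
    (hpiece : ∀ (N : ℕ) (e : Fin N → Fin M), StrictMono e → T < N →
      ∀ u : Fin n → Bool, ((univ.filter fun v : Fin N → Bool => P (zset ℓ (fun j => S (e j)) Z u v)).card : ℝ) ≤ θ * (2 : ℝ) ^ N) :
    ((univ.filter fun u : Fin n → Bool => P u).card : ℝ) ≤ (1 + θ) / 2 * (2 : ℝ) ^ n := by
  have htile := sum_card_BsetZ h hm hm1 P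
  have hbad_le := card_few_constZ_le_half h hm hm1 T hMT
  have hper : ∀ u : Fin n → Bool,
      ((univ.filter fun w : Fin M → Bool => P (BsetZ ℓ S Z u w)).card : ℝ)
        ≤ (if (cblkZ ℓ S Z u).card ≤ T then (2 : ℝ) ^ M else θ * (2 : ℝ) ^ M) := by
    intro u
    by_cases hu : (cblkZ ℓ S Z u).card ≤ T
    · rw [if_pos hu]
      have hle : (univ.filter fun w : Fin M → Bool => P (BsetZ ℓ S Z u w)).card ≤ 2 ^ M := by
        calc _ ≤ (univ : Finset (Fin M → Bool)).card := card_le_card (filter_subset _ _)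
          _ = 2 ^ M := by rw [card_univ, Fintype.card_fun, Fintype.card_bool, Fintype.card_fin]
      exact_mod_cast hle
    · rw [if_neg hu]
      exact card_BsetZ_le_gen h P hpiece u (by omega)
  have hsum : (((2 ^ M * (univ.filter fun u : Fin n → Bool => P u).card : ℕ)) : ℝ)
      ≤ ∑ u : Fin n → Bool, (if (cblkZ ℓ S Z u).card ≤ T then (2 : ℝ) ^ M else θ * (2 : ℝ) ^ M) := by
    rw [← htile]
    push_cast
    exact Finset.sum_le_sum fun u _ => hper u
  rw [Finset.sum_ite, Finset.sum_const, Finset.sum_const, nsmul_eq_mul, nsmul_eq_mul] at hsum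
  push_cast at hsum
  have htot : ((univ.filter fun u : Fin n → Bool => (cblkZ ℓ S Z u).card ≤ T).card : ℝ)
      + ((univ.filter fun u : Fin n → Bool => ¬ (cblkZ ℓ S Z u).card ≤ T).card : ℝ) = (2 : ℝ) ^ n := by
    have e := Finset.card_filter_add_card_filter_not (s := (univ : Finset (Fin n → Bool)))
      (fun u : Fin n → Bool => (cblkZ ℓ S Z u).card ≤ T)
    rw [card_univ, Fintype.card_fun, Fintype.card_bool, Fintype.card_fin] at e
    exact_mod_cast e
  have h2M : (0 : ℝ) < (2 : ℝ) ^ M := by positivity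
  set B : ℝ := ((univ.filter fun u : Fin n → Bool => (cblkZ ℓ S Z u).card ≤ T).card : ℝ) with hB
  set G : ℝ := ((univ.filter fun u : Fin n → Bool => ¬ (cblkZ ℓ S Z u).card ≤ T).card : ℝ) with hG
  set Wn : ℝ := ((univ.filter fun u : Fin n → Bool => P u).card : ℝ) with hWn
  have hsum' : (2 : ℝ) ^ M * Wn ≤ (2 : ℝ) ^ M * (B + θ * G) := by
    have e : B * (2 : ℝ) ^ M + G * (θ * (2 : ℝ) ^ M) = (2 : ℝ) ^ M * (B + θ * G) := by ring
    rw [← e]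
    exact hsum
  have hW : Wn ≤ B + θ * G := le_of_mul_le_mul_left hsum' h2M
  have hGe : G = (2 : ℝ) ^ n - B := by linarith
  have h1θ : 0 ≤ 1 - θ := by linarith
  have hprod : (1 - θ) * B ≤ (1 - θ) * ((2 : ℝ) ^ n / 2) := mul_le_mul_of_nonneg_left hbad_le h1θ
  rw [hGe] at hW
  nlinarith [hW, hprod]

/-- ★★★ **THE MASK DIAL `maskDial_hard`.**  There are `θ < 1` and `N₁` — uniform in `ℓ`, `m`, `p` and the mask — such that: for every mask size
`m ≢ 0 (mod 3)`, whenever `M ≥ 2^m·(N₁+1)` and `M ≥ 2^m·((L+1)²+1)` pairwise separated span windows `[S k, S k+ℓ)` fit into `{0,…,n−1}` and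
their masked blocks `[S k, S k+ℓ) ∩ Z` all have size `m`, every junta ⊕ linear-form strategy mod `p` with juntas of size `≤ L` whose forms are
ZERO-SUM ON EACH MASKED BLOCK (arbitrary elsewhere — also on the unmasked coordinates inside the spans —, arbitrary tables) wins the mod-3 walk game
with shift `c` on at most `θ·2ⁿ` inputs.  W-AWARE: along a piece the weight moves by multiples of `m`; the forms are frozen. -/
theorem maskDial_hard :
    ∃ θ : ℝ, θ < 1 ∧ ∃ N₁ : ℕ, ∀ (ℓ m : ℕ), (m % 3 = 1 ∨ m % 3 = 2) → ∀ (p n M L : ℕ) (S : Fin M → ℕ) (Z : Finset (Fin n)),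
      ((∀ k k', k < k' → S k + ℓ ≤ S k') ∧ (∀ k, S k + ℓ ≤ n)) → (∀ k, (zblk ℓ S Z k).card = m) →
      2 ^ m * (N₁ + 1) ≤ M → 2 ^ m * ((L + 1) * (L + 1) + 1) ≤ M →
      ∀ (c : ℕ) (D : JLinPeel.JLinData p n), (∀ g, (D.J g).card ≤ L) →
        (∀ g (k : Fin M), ∑ i ∈ zblk ℓ S Z k, D.a g i = 0) →
        ((univ.filter fun u : Fin n → Bool => ringWinU c D.strat u = true).card : ℝ) ≤ θ * (2 : ℝ) ^ n := by
  obtain ⟨θ, hθ, N₀, hpiece⟩ := maskPiece_hard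
  refine ⟨(1 + θ) / 2, by linarith, N₀, ?_⟩
  intro ℓ m hm3 p n M L S Z h hm hM₁ hM₂ c D hJ hnull
  have hm1 : 1 ≤ m := by omega
  set T : ℕ := max N₀ ((L + 1) * (L + 1)) with hT
  have hMT : 2 ^ m * (T + 1) ≤ M := by
    rcases le_total N₀ ((L + 1) * (L + 1)) with hle | hle
    · rw [hT, max_eq_right hle]; exact hM₂
    · rw [hT, max_eq_left hle]; exact hM₁
  have hTN : N₀ ≤ T := le_max_left _ _
  have hTL : (L + 1) * (L + 1) ≤ T := le_max_right _ _
  refine dialZ_of_pieces h hm hm1 hθ.le hMT (fun u : Fin n → Bool => ringWinU c D.strat u = true) ?_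
  intro N e he hTN' u
  have hmN : ∀ j : Fin N, (zblk ℓ (fun j => S (e j)) Z j).card = m := fun j => by rw [zblk_reindex e j]; exact hm (e j)
  exact hpiece ℓ m hm3 p n N (fun j => S (e j)) Z (Summit.QuantumAdvantage.AdviceFreeQNC0.JLinPeel.NullDial.sep_sub h he) hmN (by omega) L (by omega) c D hJ
    (fun g j => by rw [zblk_reindex e j]; exact hnull g (e j)) u

/-! #### consistency: a mask containing the spans gives back the null dial (zero-sum WINDOWS, `m = ℓ`) -/

/-- if the mask contains the span window `k`, the masked block is the whole window. -/
theorem zblk_eq_blk_of_subset (k : Fin M) (hZ : blk ℓ S k ⊆ Z) : zblk ℓ S Z k = blk ℓ S k := by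
  unfold zblk
  exact Finset.filter_true_of_mem fun i hi => hZ hi

-- `nullDial_of_maskDial` (the null dial as the sub-case Z-blocks of equal residue) is omitted at landing: its statement restates the landed
-- `NullDial.nullDial_hard` (gate dedup pre-empted); the derivation is in the annex §38h.

end MaskAssembly

end Summit.QuantumAdvantage.AdviceFreeQNC0.JLinPeel.MaskDial
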